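import Literature.Geometry.Riemannian.L2HarmonicOneFormsSobolev
import Literature.Geometry.Riemannian.LipschitzSmoothingCompactSupport
import Literature.Geometry.Riemannian.MetricCutoff
import Literature.Geometry.Riemannian.HopfRinowHeineBorel
import Literature.Geometry.Riemannian.CutLocusProofs
import Literature.Geometry.Lorentzian.VolumeSmallBalls
import Literature.Geometry.Lorentzian.VolumeRadius
import HarnessLib

/-!
# A Sobolev inequality forces volume growth `vol B(x, r) ≥ C μ^{p/2} r^p`
(Carron 1996, Prop. 2.4; Akutagawa 1994; Carron 2007, proof of Prop. 2.11)

Fourth layer (geometry ⇄ analysis) of the proof programme of the named fact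
`Literature.Geometry.Riemannian.Carron1998_ends_le_rank_l2HarmonicOneForms`
(`L2HarmonicOneFormsSobolev.lean`). G. Carron, *L² harmonic forms on non-compact Riemannian
manifolds*, arXiv:0704.3194 (2007), proof of Prop. 2.11: "according to (proposition 2.4 in
[car-smf]), we know that the Sobolev inequality (2.11) implies a uniform lower bound on the
volume of geodesic balls: `∀ x ∈ M, ∀ r ≥ 0 : vol B(x, r) ≥ C(ν) (μ r²)^{ν/2}` … such an
estimate implies that all the unbounded connected components of `M ∖ supp α` have infinite
volume." For a complete connected Riemannian manifold `(X, h)` (boundaryless real model with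
corners `I` on a finite-dimensional `E`, `h` a smooth Mathlib Riemannian metric, completeness as
geodesic completeness of the Levi-Civita connection of `ofRiemannian h`) satisfying the tree's
`HasSobolevInequality h p μ` (`p > 2`, `μ > 0`), we PROVE

* `exists_smooth_ball_cutoff` — smooth cutoffs adapted to geodesic balls on a COMPLETE manifold:
  `χ ∈ C_c^∞(X; [0,1])`, `χ = 1` on `B(x, s/2)`, `tsupport χ ⊆ B(x, s)`, `|∇χ|²_h ≤ C₀/s²`
  (the raw cutoff `θ(d(x,·)/s)` of `MetricCutoff.exists_raw_cutoff` has compact support by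
  Hopf–Rinow, `isCompact_setOf_edist_le`, and is smoothed by
  `exists_contMDiff_approx_of_hasCompactSupport` and clamped as in `exists_metric_cutoff`);
* `sobolev_volume_doubling_step` — the one-step inequality
  `μ · vol B(x, s/2)^{1-2/p} ≤ (C₀/s²) · vol B(x, s)` obtained by testing `(S_p)` on `χ`;
* `exists_mul_rpow_le_measure_ball_of_hasSobolevInequality` — **the volume lower bound**: there is
  `c > 0` (depending on `p`, `μ`, `C₀`) with `c · r^p ≤ vol B(x, r)` for all `x` and `r > 0`
  (iterate the step along `r/2ʲ` and start from `vol B(x, ρ) ≥ c₀ ρⁿ` for small `ρ`,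
  `exists_nhds_mul_pow_le_riemannianVolume`; the telescoped logarithmic inequality converges since
  `θʲ · j → 0`, `θ = 1 - 2/p`);
* `measure_eq_top_of_forall_exists_ball_subset` — a set containing geodesic balls of every radius
  has infinite volume (hence, with `exists_setOf_edist_lt_subset_diff`, the ends of `X` have
  infinite volume, Carron's Lemma 2.7).

Everything is proved; no definitions, no named facts (D-0026).

## References

* G. Carron, *L² harmonic forms on non-compact Riemannian manifolds*, arXiv:0704.3194 (2007),
  Prop. 2.11 (proof) and Lemma 2.7. [`Carron2007`]
* G. Carron, *Inégalités isopérimétriques de Faber–Krahn et conséquences*, in: Actes de la table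
  ronde de géométrie différentielle (Luminy, 1992), Sémin. Congr. 1, SMF (1996), Prop. 2.4
  (the reference "[car-smf]").
* K. Akutagawa, *Yamabe metrics of positive scalar curvature and conformally flat manifolds*,
  Differential Geom. Appl. 4 (1994), 239–258 (volume growth from a Sobolev inequality).
-/

noncomputable section

open Bundle Set Function Filter Topology MeasureTheory
open scoped Manifold ContDiff ENNReal NNReal

namespace Literature.Geometry.Riemannian

open Literature.Geometry.Lorentzian
open Literature.Geometry.Lorentzian.PseudoRiemannianMetric

variable {E : Type*} [NormedAddCommGroup E] [NormedSpace ℝ E] [FiniteDimensional ℝ E]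
  {H : Type*} [TopologicalSpace H] {I : ModelWithCorners ℝ E H} [I.Boundaryless]
  {X : Type*} [TopologicalSpace X] [ChartedSpace H X] [IsManifold I ∞ X]
  [T3Space X] [SecondCountableTopology X] [ConnectedSpace X] [MeasurableSpace X] [BorelSpace X]
  (h : ContMDiffRiemannianMetric I ∞ E (TangentSpace I : X → Type _))
  [(PseudoRiemannianMetric.ofRiemannian h).HasLeviCivita]

omit [I.Boundaryless] [T3Space X] [SecondCountableTopology X] [ConnectedSpace X] [MeasurableSpace X]
  [BorelSpace X] in
/-- The Levi-Civita connection of the smooth metric `ofRiemannian h` is `C¹` (instance form of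
`isLocallyContMDiff_leviCivita_holds`, Gallot–Hulin–Lafontaine 2004, Prop. 2.54). [folklore] -/
theorem contMDiffCovariantDerivative_leviCivita_ofRiemannian_one :
    CovariantDerivative.ContMDiffCovariantDerivative
      (PseudoRiemannianMetric.ofRiemannian h).leviCivita 1 := by
  haveI : CompleteSpace E := FiniteDimensional.complete ℝ E
  haveI : Fact ((1 : ℕ∞ω) ≤ ((⊤ : ℕ∞) : ℕ∞ω)) := ⟨by exact_mod_cast le_top⟩
  exact ⟨(PseudoRiemannianMetric.ofRiemannian h).isLocallyContMDiff_leviCivita_holds 1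
    (by rw [show ((1 : ℕ∞) : ℕ∞ω) + 1 = 2 by norm_num]; exact WithTop.coe_le_coe.2 le_top)
    univ isOpen_univ⟩

/-! ### Smooth cutoffs adapted to geodesic balls on a complete manifold -/

omit [MeasurableSpace X] [BorelSpace X] in
/-- **Smooth ball cutoffs on a complete manifold** (Carron 2007, proof of Prop. 2.11, the test
functions of Carron 1996, Prop. 2.4 "by approximation"; cf. `MetricCutoff.exists_metric_cutoff`
for closed manifolds). For a complete connected `(X, h)` there is `C₀ > 0` such that for every
`x` and `s > 0` there is a `C^∞` function `χ : X → [0, 1]` with compact support,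
`χ = 1` on `B(x, s/2)`, `tsupport χ ⊆ B(x, s)` and `|∇χ|²_h ≤ C₀ / s²` everywhere.
[cite: Carron2007, Prop. 2.11 (proof)] -/
theorem exists_smooth_ball_cutoff
    (hc : IsGeodesicallyComplete (PseudoRiemannianMetric.ofRiemannian h).leviCivita) :
    ∃ C₀ : ℝ, 0 < C₀ ∧ ∀ (x : X) (s : ℝ), 0 < s → ∃ χ : X → ℝ,
      ContMDiff I 𝓘(ℝ, ℝ) ∞ χ ∧ HasCompactSupport χ ∧ (∀ y, 0 ≤ χ y) ∧ (∀ y, χ y ≤ 1) ∧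
      (∀ y, (PseudoRiemannianMetric.ofRiemannian h).edist (isRiemannian_ofRiemannian h) x y <
        ENNReal.ofReal (s / 2) → χ y = 1) ∧
      tsupport χ ⊆ {y | (PseudoRiemannianMetric.ofRiemannian h).edist
        (isRiemannian_ofRiemannian h) x y < ENNReal.ofReal s} ∧
      ∀ y, (PseudoRiemannianMetric.ofRiemannian h).gradSq χ y ≤ C₀ / s ^ 2 := by
  haveI : CompleteSpace E := FiniteDimensional.complete ℝ E
  haveI : LocallyCompactSpace X := Manifold.locallyCompact_of_finiteDimensional I
  haveI := contMDiffCovariantDerivative_leviCivita_ofRiemannian_one h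
  set g := PseudoRiemannianMetric.ofRiemannian h with hgdef
  have hg : g.IsRiemannian := isRiemannian_ofRiemannian h
  obtain ⟨Λ, C, hC0, hΛs, hΛ0, hΛ1, hΛzero, hΛone, hΛd⟩ := exists_smooth_clamp
  refine ⟨25 * C ^ 2 + 1, by positivity, fun x s hs ↦ ?_⟩
  -- the raw cutoff, compactly supported by Hopf–Rinow
  obtain ⟨F, hFc, hF0, hF1, hFone, hFpos, hFlip⟩ := exists_raw_cutoff hg x hs
  have hball : IsOpen {y | g.edist hg x y < ENNReal.ofReal s} := isOpen_setOf_edist_lt hg x _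
  have hsuppF : tsupport F ⊆ {y | g.edist hg x y ≤ ENNReal.ofReal (3 * s / 4)} := by
    refine closure_minimal (fun y hy ↦ ?_) (isClosed_le ((continuous_edist hg).comp
      (continuous_const.prodMk continuous_id)) continuous_const)
    exact (hFpos y (lt_of_le_of_ne (hF0 y) (Ne.symm hy))).le
  have hFcs : HasCompactSupport F := by
    have hK : IsCompact {y | g.edist hg x y ≤ ENNReal.ofReal (3 * s / 4)} :=
      isCompact_setOf_edist_le g le_rfl hg hc x (3 * s / 4).toNNReal
    exact hK.of_isClosed_subset (isClosed_tsupport F) hsuppF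
  have hFW : tsupport F ⊆ {y | g.edist hg x y < ENNReal.ofReal s} := fun y hy ↦
    (hsuppF hy).trans_lt (ENNReal.ofReal_lt_ofReal_iff_of_nonneg (by positivity) |>.2 (by linarith))
  -- smoothing with compact support inside `B(x, s)`
  set ε : ℝ := min (1 / 8) (1 / s) with hε
  have hεpos : 0 < ε := by positivity
  have hε8 : ε ≤ 1 / 8 := min_le_left _ _
  have hεs : ε ≤ 1 / s := min_le_right _ _
  obtain ⟨χt, hχts, hχtc, hχtW, hχtF, hχtgrad⟩ := exists_contMDiff_approx_of_hasCompactSupport g hg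
    hFc hFcs (by positivity : (0 : ℝ) ≤ 4 / s) hFlip hball hFW hεpos
  -- clamp
  have hsupp : tsupport (fun y ↦ Λ (χt y)) ⊆ tsupport χt := by
    refine closure_minimal (fun y hy ↦ subset_closure ?_) (isClosed_tsupport _)
    intro h0
    exact hy (show Λ (χt y) = 0 by rw [h0]; exact hΛzero 0 (by norm_num))
  refine ⟨fun y ↦ Λ (χt y), hΛs.comp_contMDiff hχts, hχtc.of_isClosed_subset (isClosed_tsupport _)
    hsupp, fun y ↦ hΛ0 _, fun y ↦ hΛ1 _, fun y hy ↦ ?_, hsupp.trans hχtW, fun y ↦ ?_⟩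
  · -- `= 1` on `B(x, s/2)`: there `F = 1`, so `χt > 7/8 ≥ 3/4`
    have h1 := hFone y hy
    have h2 := hχtF y
    rw [h1] at h2
    exact hΛone _ (by linarith [(abs_lt.1 h2).1])
  · -- gradient
    have hd : HasDerivAt Λ (deriv Λ (χt y)) (χt y) :=
      ((hΛs.differentiable (by simp)) _).hasDerivAt
    have hmd : MDifferentiableAt I 𝓘(ℝ, ℝ) χt y := (hχts y).mdifferentiableAt (by simp)
    rw [show (fun y ↦ Λ (χt y)) = Λ ∘ χt from rfl, g.gradSq_real_comp hd hmd]
    have h1 : deriv Λ (χt y) ^ 2 ≤ C ^ 2 := by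
      rw [← sq_abs]
      exact pow_le_pow_left₀ (abs_nonneg _) (hΛd _) 2
    have h2 : g.gradSq χt y ≤ (5 / s) ^ 2 := by
      refine (hχtgrad y).trans (pow_le_pow_left₀ (by positivity) ?_ 2)
      calc 4 / s + ε ≤ 4 / s + 1 / s := by linarith
        _ = 5 / s := by ring
    have h3 : 0 ≤ g.gradSq χt y := g.gradSq_nonneg hg χt y
    calc deriv Λ (χt y) ^ 2 * g.gradSq χt y ≤ C ^ 2 * (5 / s) ^ 2 :=
          mul_le_mul h1 h2 h3 (sq_nonneg _)
      _ = 25 * C ^ 2 / s ^ 2 := by ring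
      _ ≤ (25 * C ^ 2 + 1) / s ^ 2 := by gcongr; linarith

/-! ### The one-step inequality from the Sobolev inequality -/

omit [I.Boundaryless] [ConnectedSpace X] [(ofRiemannian h).HasLeviCivita] in
/-- **Testing the Sobolev inequality on a ball cutoff** (Carron 1996, Prop. 2.4; the first step
of the proof of the volume bound quoted in Carron 2007, Prop. 2.11): if `χ ∈ C_c^∞(X; [0,1])`,
`χ = 1` on `B(x, s/2)`, `tsupport χ ⊆ B(x, s)` and `|∇χ|² ≤ C₀/s²`, then
`μ · vol B(x, s/2)^{1 - 2/p} ≤ (C₀/s²) · vol B(x, s)`. [cite: Carron2007, Prop. 2.11 (proof)] -/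
theorem sobolev_volume_doubling_step {p μ : ℝ} (hp : 2 < p) (hS : HasSobolevInequality h p μ)
    {x : X}
    {s C₀ : ℝ} {χ : X → ℝ} (hχs : ContMDiff I 𝓘(ℝ, ℝ) ∞ χ)
    (hχc : HasCompactSupport χ)
    (hχ1 : ∀ y, (PseudoRiemannianMetric.ofRiemannian h).edist (isRiemannian_ofRiemannian h) x y <
        ENNReal.ofReal (s / 2) → χ y = 1)
    (hχsupp : tsupport χ ⊆ {y | (PseudoRiemannianMetric.ofRiemannian h).edist
        (isRiemannian_ofRiemannian h) x y < ENNReal.ofReal s})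
    (hχgrad : ∀ y, (PseudoRiemannianMetric.ofRiemannian h).gradSq χ y ≤ C₀ / s ^ 2) :
    ENNReal.ofReal μ * (riemannianMeasure h {y | (PseudoRiemannianMetric.ofRiemannian h).edist
        (isRiemannian_ofRiemannian h) x y < ENNReal.ofReal (s / 2)}) ^ (1 - 2 / p) ≤
      ENNReal.ofReal (C₀ / s ^ 2) * riemannianMeasure h {y |
        (PseudoRiemannianMetric.ofRiemannian h).edist (isRiemannian_ofRiemannian h) x y <
          ENNReal.ofReal s} := by
  haveI : LocallyCompactSpace X := Manifold.locallyCompact_of_finiteDimensional I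
  set g := PseudoRiemannianMetric.ofRiemannian h with hgdef
  have hg : g.IsRiemannian := isRiemannian_ofRiemannian h
  have hSχ := hS χ hχs hχc
  -- lower bound for the `L^q` integral
  have hmeas : MeasurableSet {y | g.edist hg x y < ENNReal.ofReal (s / 2)} :=
    (isOpen_setOf_edist_lt hg x _).measurableSet
  have hL : riemannianMeasure h {y | g.edist hg x y < ENNReal.ofReal (s / 2)} ≤
      ∫⁻ y, ENNReal.ofReal (|χ y| ^ (2 * p / (p - 2))) ∂(riemannianMeasure h) := by
    rw [← lintegral_indicator_one hmeas]
    refine lintegral_mono fun y ↦ ?_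
    by_cases hy : y ∈ {y | g.edist hg x y < ENNReal.ofReal (s / 2)}
    · rw [indicator_of_mem hy, hχ1 y hy]
      simp
    · rw [indicator_of_notMem hy]
      exact zero_le
  -- upper bound for the energy
  have hmeas' : MeasurableSet (tsupport χ) := (isClosed_tsupport χ).measurableSet
  have hR : ∫⁻ y, ENNReal.ofReal (g.innerDual y (mvfderiv I χ y).toLinearMap
      (mvfderiv I χ y).toLinearMap) ∂(riemannianMeasure h) ≤
      ENNReal.ofReal (C₀ / s ^ 2) * riemannianMeasure h {y | g.edist hg x y < ENNReal.ofReal s} := by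
    calc ∫⁻ y, ENNReal.ofReal (g.innerDual y (mvfderiv I χ y).toLinearMap
          (mvfderiv I χ y).toLinearMap) ∂(riemannianMeasure h)
        ≤ ∫⁻ y, (tsupport χ).indicator (fun _ ↦ ENNReal.ofReal (C₀ / s ^ 2)) y
            ∂(riemannianMeasure h) := by
          refine lintegral_mono fun y ↦ ?_
          by_cases hy : y ∈ tsupport χ
          · rw [indicator_of_mem hy]
            exact ENNReal.ofReal_le_ofReal (hχgrad y)
          · rw [indicator_of_notMem hy, mvfderiv_eq_zero_of_notMem_tsupport hy]
            simp [PseudoRiemannianMetric.innerDual]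
      _ = ENNReal.ofReal (C₀ / s ^ 2) * riemannianMeasure h (tsupport χ) :=
          lintegral_indicator_const hmeas' _
      _ ≤ ENNReal.ofReal (C₀ / s ^ 2) * riemannianMeasure h {y | g.edist hg x y < ENNReal.ofReal s} :=
          mul_le_mul' le_rfl (measure_mono hχsupp)
  calc ENNReal.ofReal μ * (riemannianMeasure h {y | g.edist hg x y < ENNReal.ofReal (s / 2)}) ^
        (1 - 2 / p)
      ≤ ENNReal.ofReal μ * (∫⁻ y, ENNReal.ofReal (|χ y| ^ (2 * p / (p - 2)))
          ∂(riemannianMeasure h)) ^ (1 - 2 / p) := by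
        refine mul_le_mul' le_rfl (ENNReal.rpow_le_rpow hL ?_)
        have h2p : 2 / p ≤ 1 := by rw [div_le_one (by linarith)]; linarith
        linarith
    _ ≤ _ := hSχ
    _ ≤ _ := hR

/-! ### The iteration -/

/-- **The telescoping iteration behind the volume bound** (Carron 1996, proof of Prop. 2.4;
Akutagawa 1994): if positive numbers `a₀, a₁, …` satisfy `log aⱼ ≥ (A - j B) + θ log aⱼ₊₁` with
`0 ≤ θ < 1`, and `log a_J ≥ D - K J` for all large `J`, then
`log a₀ ≥ A/(1 - θ) - B θ/(1 - θ)²` (telescope to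
`log a₀ ≥ ∑_{i<J} θⁱ (A - iB) + θᴶ log a_J` and let `J → ∞`, using `J θᴶ → 0`). [folklore] -/
theorem log_iteration_bound {θ A B D K : ℝ} (hθ0 : 0 ≤ θ) (hθ1 : θ < 1) {a : ℕ → ℝ}
    (hstep : ∀ j : ℕ, A - j * B + θ * Real.log (a (j + 1)) ≤ Real.log (a j))
    {J₀ : ℕ} (hlow : ∀ J : ℕ, J₀ ≤ J → D - K * J ≤ Real.log (a J)) :
    A / (1 - θ) - B * (θ / (1 - θ) ^ 2) ≤ Real.log (a 0) := by
  -- telescoping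
  have htel : ∀ J : ℕ, (∑ i ∈ Finset.range J, θ ^ i * (A - i * B)) + θ ^ J * Real.log (a J) ≤
      Real.log (a 0) := by
    intro J
    induction J with
    | zero => simp
    | succ J ih =>
      have h1 : θ ^ J * (A - J * B + θ * Real.log (a (J + 1))) ≤ θ ^ J * Real.log (a J) :=
        mul_le_mul_of_nonneg_left (hstep J) (pow_nonneg hθ0 J)
      rw [Finset.sum_range_succ, pow_succ]
      nlinarith [h1, ih]
  -- the limit of the right-hand sides
  have hθn : ‖θ‖ < 1 := by rw [Real.norm_eq_abs, abs_of_nonneg hθ0]; exact hθ1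
  have hS1 : Tendsto (fun J ↦ ∑ i ∈ Finset.range J, θ ^ i) atTop (𝓝 (1 - θ)⁻¹) :=
    (hasSum_geometric_of_lt_one hθ0 hθ1).tendsto_sum_nat
  have hS2 : Tendsto (fun J ↦ ∑ i ∈ Finset.range J, (i : ℝ) * θ ^ i) atTop
      (𝓝 (θ / (1 - θ) ^ 2)) :=
    (hasSum_coe_mul_geometric_of_norm_lt_one hθn).tendsto_sum_nat
  have hS : Tendsto (fun J ↦ ∑ i ∈ Finset.range J, θ ^ i * (A - i * B)) atTop
      (𝓝 (A * (1 - θ)⁻¹ - B * (θ / (1 - θ) ^ 2))) := by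
    have heq : ∀ J, ∑ i ∈ Finset.range J, θ ^ i * (A - i * B) =
        A * ∑ i ∈ Finset.range J, θ ^ i - B * ∑ i ∈ Finset.range J, (i : ℝ) * θ ^ i := by
      intro J
      rw [Finset.mul_sum, Finset.mul_sum, ← Finset.sum_sub_distrib]
      exact Finset.sum_congr rfl fun i _ ↦ by ring
    simp_rw [heq]
    exact (hS1.const_mul A).sub (hS2.const_mul B)
  have hT : Tendsto (fun J : ℕ ↦ θ ^ J * (D - K * J)) atTop (𝓝 0) := by
    have h1 : Tendsto (fun J : ℕ ↦ θ ^ J) atTop (𝓝 0) := tendsto_pow_atTop_nhds_zero_of_lt_one hθ0 hθ1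
    have h2 : Tendsto (fun J : ℕ ↦ (J : ℝ) * θ ^ J) atTop (𝓝 0) :=
      tendsto_self_mul_const_pow_of_lt_one hθ0 hθ1
    have heq : ∀ J : ℕ, θ ^ J * (D - K * J) = D * θ ^ J - K * ((J : ℝ) * θ ^ J) := fun J ↦ by ring
    simp_rw [heq]
    simpa using (h1.const_mul D).sub (h2.const_mul K)
  have hlim : Tendsto (fun J : ℕ ↦ (∑ i ∈ Finset.range J, θ ^ i * (A - i * B)) + θ ^ J * (D - K * J))
      atTop (𝓝 (A * (1 - θ)⁻¹ - B * (θ / (1 - θ) ^ 2))) := by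
    simpa using hS.add hT
  have hev : ∀ᶠ J : ℕ in atTop, (∑ i ∈ Finset.range J, θ ^ i * (A - i * B)) + θ ^ J * (D - K * J) ≤
      Real.log (a 0) := by
    filter_upwards [eventually_ge_atTop J₀] with J hJ
    have h1 : θ ^ J * (D - K * J) ≤ θ ^ J * Real.log (a J) :=
      mul_le_mul_of_nonneg_left (hlow J hJ) (pow_nonneg hθ0 J)
    linarith [htel J]
  have := le_of_tendsto hlim hev
  rwa [div_eq_mul_inv]

/-! ### The volume lower bound -/

/-- **A Sobolev inequality forces `vol B(x, r) ≥ c r^p`** (Carron 1996, Prop. 2.4, as used in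
Carron 2007, proof of Prop. 2.11: "`∀ x ∈ M, ∀ r ≥ 0 : vol B(x, r) ≥ C(ν) (μ r²)^{ν/2}`"; also
Akutagawa 1994). For a complete connected `(X, h)` satisfying the Sobolev inequality `(S_p)` with
constant `μ > 0`, `p > 2`, there is `c > 0` with `c · r^p ≤ vol_h B(x, r)` for every `x ∈ X` and
`r > 0`. Proof: with the ball cutoffs of `exists_smooth_ball_cutoff` the Sobolev inequality gives
`vol B(x, s) ≥ (μ s²/C₀) vol B(x, s/2)^{1-2/p}` (`sobolev_volume_doubling_step`); iterating along
`s = r/2ʲ` and using `vol B(x, ρ) ≥ c₀ ρⁿ` for small `ρ` (`exists_nhds_mul_pow_le_riemannianVolume`,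
the metric being smooth) the telescoped inequality yields in the limit
`vol B(x, r) ≥ (μ/C₀)^{p/2} 4^{-p(p-2)/4} r^p` (`log_iteration_bound`).
[cite: Carron2007, Prop. 2.11 (proof)] -/
theorem exists_mul_rpow_le_measure_ball_of_hasSobolevInequality
    (hc : IsGeodesicallyComplete (PseudoRiemannianMetric.ofRiemannian h).leviCivita)
    {p μ : ℝ} (hp : 2 < p) (hμ : 0 < μ) (hS : HasSobolevInequality h p μ) :
    ∃ c : ℝ, 0 < c ∧ ∀ (x : X) (r : ℝ), 0 < r →
      ENNReal.ofReal (c * r ^ p) ≤ riemannianMeasure h {y |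
        (PseudoRiemannianMetric.ofRiemannian h).edist (isRiemannian_ofRiemannian h) x y <
          ENNReal.ofReal r} := by
  haveI : CompleteSpace E := FiniteDimensional.complete ℝ E
  haveI : LocallyCompactSpace X := Manifold.locallyCompact_of_finiteDimensional I
  haveI := contMDiffCovariantDerivative_leviCivita_ofRiemannian_one h
  set g := PseudoRiemannianMetric.ofRiemannian h with hgdef
  have hg : g.IsRiemannian := isRiemannian_ofRiemannian h
  obtain ⟨C₀, hC₀, hcut⟩ := exists_smooth_ball_cutoff h hc
  -- the constant
  set θ : ℝ := 1 - 2 / p with hθ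
  have hp0 : 0 < p := by linarith
  have hθ0 : 0 ≤ θ := by
    have : 2 / p ≤ 1 := by rw [div_le_one hp0]; linarith
    rw [hθ]; linarith
  have hθ1 : θ < 1 := by
    have : 0 < 2 / p := by positivity
    rw [hθ]; linarith
  have h1θ : 1 - θ = 2 / p := by rw [hθ]; ring
  set c : ℝ := Real.exp (p / 2 * Real.log (μ / C₀) - Real.log 4 * (θ / (1 - θ) ^ 2)) with hcdef
  refine ⟨c, Real.exp_pos _, fun x r hr ↦ ?_⟩
  -- the volumes of the balls `B(x, ρ)`
  set V : ℝ → ℝ≥0∞ := fun ρ ↦ riemannianMeasure h {y | g.edist hg x y < ENNReal.ofReal ρ} with hV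
  have hVpos : ∀ ρ : ℝ, 0 < ρ → 0 < V ρ := by
    intro ρ hρ
    have hx : x ∈ {y | g.edist hg x y < ENNReal.ofReal ρ} := by
      simp only [mem_setOf_eq, PseudoRiemannianMetric.edist_self]
      exact ENNReal.ofReal_pos.2 hρ
    exact riemannianVolume_pos_of_isOpen h (isOpen_setOf_edist_lt hg x _) ⟨x, hx⟩
  have hVfin : ∀ ρ : ℝ, V ρ < ⊤ := by
    intro ρ
    have hK : IsCompact {y | g.edist hg x y ≤ ENNReal.ofReal ρ} :=
      isCompact_setOf_edist_le g le_rfl hg hc x ρ.toNNReal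
    exact lt_of_le_of_lt (measure_mono fun y (hy : g.edist hg x y < _) ↦ (hy.le : g.edist hg x y ≤ _))
      (riemannianVolume_lt_top_of_isCompact_holds h le_rfl hK)
  -- the sequence `a j = vol B(x, r/2ʲ)` (real, positive)
  set a : ℕ → ℝ := fun j ↦ (V (r / 2 ^ j)).toReal with ha
  have hapos : ∀ j, 0 < a j := fun j ↦
    ENNReal.toReal_pos (hVpos _ (by positivity)).ne' (hVfin _).ne
  -- the one-step inequality in logarithmic form
  have hstep : ∀ j : ℕ, Real.log (μ * r ^ 2 / C₀) - j * Real.log 4 + θ * Real.log (a (j + 1)) ≤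
      Real.log (a j) := by
    intro j
    set s : ℝ := r / 2 ^ j with hs
    have hspos : 0 < s := by positivity
    obtain ⟨χ, hχs, hχc, -, -, hχ1, hχsupp, hχgrad⟩ := hcut x s hspos
    have hE := sobolev_volume_doubling_step h hp hS hχs hχc hχ1 hχsupp hχgrad
    -- in real numbers: `μ a_{j+1}^θ ≤ (C₀/s²) a_j`
    have hs2 : s / 2 = r / 2 ^ (j + 1) := by rw [hs, pow_succ]; ring
    have hfin1 : ENNReal.ofReal (C₀ / s ^ 2) * V s ≠ ⊤ :=
      ENNReal.mul_ne_top ENNReal.ofReal_ne_top (hVfin s).ne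
    have hreal := ENNReal.toReal_mono hfin1 hE
    rw [ENNReal.toReal_mul, ENNReal.toReal_mul, ENNReal.toReal_ofReal hμ.le,
      ENNReal.toReal_ofReal (by positivity), ← ENNReal.toReal_rpow, hs2] at hreal
    change μ * a (j + 1) ^ θ ≤ C₀ / s ^ 2 * a j at hreal
    -- logarithms
    have hK : 0 < μ * s ^ 2 / C₀ := by positivity
    have h1 : μ * s ^ 2 / C₀ * a (j + 1) ^ θ ≤ a j := by
      have := mul_le_mul_of_nonneg_left hreal (by positivity : (0 : ℝ) ≤ s ^ 2 / C₀)
      calc μ * s ^ 2 / C₀ * a (j + 1) ^ θ = s ^ 2 / C₀ * (μ * a (j + 1) ^ θ) := by ring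
        _ ≤ s ^ 2 / C₀ * (C₀ / s ^ 2 * a j) := this
        _ = a j := by field_simp
    have h2 := Real.log_le_log (mul_pos hK (Real.rpow_pos_of_pos (hapos _) θ)) h1
    rw [Real.log_mul hK.ne' (Real.rpow_pos_of_pos (hapos _) θ).ne',
      Real.log_rpow (hapos _)] at h2
    have h3 : Real.log (μ * s ^ 2 / C₀) = Real.log (μ * r ^ 2 / C₀) - j * Real.log 4 := by
      have : μ * s ^ 2 / C₀ = μ * r ^ 2 / C₀ / 4 ^ j := by
        rw [hs, div_pow, ← pow_mul, show (2 : ℝ) ^ (j * 2) = 4 ^ j by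
          rw [mul_comm, pow_mul]; norm_num]
        ring
      rw [this, Real.log_div (by positivity) (by positivity), Real.log_pow]
    linarith
  -- the small-ball lower bound `a J ≥ c₀ (r/2ᴶ)ⁿ` for large `J`
  obtain ⟨c₀, hc₀, ρ₀, hρ₀, U, hU, hsmall⟩ := exists_nhds_mul_pow_le_riemannianVolume h x
  obtain ⟨J₀, hJ₀⟩ : ∃ J₀ : ℕ, r / 2 ^ J₀ ≤ ρ₀ := by
    obtain ⟨J₀, hJ₀⟩ := pow_unbounded_of_one_lt (r / ρ₀) (by norm_num : (1 : ℝ) < 2)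
    refine ⟨J₀, ?_⟩
    rw [div_le_iff₀ (by positivity)]
    rw [div_lt_iff₀ hρ₀] at hJ₀
    linarith
  have hlow : ∀ J : ℕ, J₀ ≤ J → (Real.log c₀ + Module.finrank ℝ E * Real.log r) -
      (Module.finrank ℝ E * Real.log 2) * J ≤ Real.log (a J) := by
    intro J hJ
    have hrJ : r / 2 ^ J ≤ ρ₀ := by
      refine le_trans ?_ hJ₀
      exact div_le_div_of_nonneg_left hr.le (by positivity) (pow_le_pow_right₀ (by norm_num) hJ)
    have hle := hsmall x (mem_of_mem_nhds hU) (r / 2 ^ J) (by positivity) hrJ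
    -- `ofReal (c₀ (r/2ᴶ)ⁿ) ≤ V (r/2ᴶ)`
    have hle' : c₀ * (r / 2 ^ J) ^ Module.finrank ℝ E ≤ a J := by
      have := ENNReal.toReal_mono (hVfin (r / 2 ^ J)).ne hle
      rwa [ENNReal.toReal_ofReal (by positivity)] at this
    have h2 := Real.log_le_log (by positivity) hle'
    rw [Real.log_mul hc₀.ne' (by positivity), Real.log_pow, Real.log_div hr.ne' (by positivity),
      Real.log_pow] at h2
    linarith
  -- conclude
  have hmain := log_iteration_bound hθ0 hθ1 (A := Real.log (μ * r ^ 2 / C₀)) (B := Real.log 4)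
    (a := a) (fun j ↦ hstep j) hlow
  -- `A/(1-θ) - B θ/(1-θ)² = log c + p log r`
  have hA : Real.log (μ * r ^ 2 / C₀) / (1 - θ) - Real.log 4 * (θ / (1 - θ) ^ 2) =
      Real.log c + p * Real.log r := by
    rw [hcdef, Real.log_exp, h1θ, show μ * r ^ 2 / C₀ = μ / C₀ * r ^ 2 by ring,
      Real.log_mul (by positivity) (by positivity), Real.log_pow]
    field_simp
    ring
  rw [hA] at hmain
  have hexp : c * r ^ p ≤ a 0 := by
    have := Real.exp_le_exp.2 hmain
    rwa [Real.exp_add, Real.exp_log (Real.exp_pos _), Real.exp_log (hapos 0),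
      show Real.exp (p * Real.log r) = r ^ p by rw [Real.rpow_def_of_pos hr, mul_comm]] at this
  calc ENNReal.ofReal (c * r ^ p) ≤ ENNReal.ofReal (a 0) := ENNReal.ofReal_le_ofReal hexp
    _ = V r := by rw [ha]; simp only [pow_zero, div_one]; exact ENNReal.ofReal_toReal (hVfin r).ne

/-- **Sets containing arbitrarily large balls have infinite volume** under a Sobolev inequality
(Carron 2007, proof of Prop. 2.11 and Lemma 2.7: "such an estimate implies that all the unbounded
connected components … have infinite volume"). [cite: Carron2007, Prop. 2.11 (proof)] -/
theorem measure_eq_top_of_forall_exists_ball_subset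
    (hc : IsGeodesicallyComplete (PseudoRiemannianMetric.ofRiemannian h).leviCivita)
    {p μ : ℝ} (hp : 2 < p) (hμ : 0 < μ) (hS : HasSobolevInequality h p μ) {S : Set X}
    (hballs : ∀ r : ℝ, ∃ x : X, {y | (PseudoRiemannianMetric.ofRiemannian h).edist
      (isRiemannian_ofRiemannian h) x y < ENNReal.ofReal r} ⊆ S) :
    riemannianMeasure h S = ⊤ := by
  obtain ⟨c, hc0, hvol⟩ := exists_mul_rpow_le_measure_ball_of_hasSobolevInequality h hc hp hμ hS
  refine ENNReal.eq_top_of_forall_nnreal_le fun R ↦ ?_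
  -- choose `r` with `c r^p ≥ R`
  have hp0 : 0 < p := by linarith
  set r : ℝ := ((R : ℝ) / c + 1) ^ (1 / p) with hr
  have hrpos : 0 < r := Real.rpow_pos_of_pos (by positivity) _
  have hrp : r ^ p = (R : ℝ) / c + 1 := by
    rw [hr, ← Real.rpow_mul (by positivity), one_div_mul_cancel hp0.ne', Real.rpow_one]
  obtain ⟨x, hx⟩ := hballs r
  calc (R : ℝ≥0∞) = ENNReal.ofReal R := (ENNReal.ofReal_coe_nnreal).symm
    _ ≤ ENNReal.ofReal (c * r ^ p) := ENNReal.ofReal_le_ofReal (by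
        rw [hrp, mul_add, mul_div_cancel₀ _ hc0.ne']; linarith)
    _ ≤ riemannianMeasure h _ := hvol x r hrpos
    _ ≤ riemannianMeasure h S := measure_mono hx

end Literature.Geometry.Riemannian

end
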